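import Literature.NumberTheory.GaloisRepresentations.MaxUnramifiedIntegers
import Literature.NumberTheory.GaloisRepresentations.WeilGroupDensityProofs
import Literature.NumberTheory.GaloisRepresentations.LocalClassFieldTheoryProofs
import Mathlib.RingTheory.RootsOfUnity.AlgebraicallyClosed
import Mathlib.FieldTheory.KrullTopology
import Mathlib.FieldTheory.IntermediateField.Adjoin.Basic
import HarnessLib

/-!
# The residues fixed by an open subgroup `H ⊇ I_F` of index `m` are `𝔽_{q^m}`
# (`Γ_F/I_F ≅ Gal(k̄/k)` compatibly with indices; Serre, *Local Fields* I §7–8, III §5)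

For a non-archimedean local field `F` (valued model), `Γ_F = Gal(F̄/F)`, `I_F = absInertia F`,
`S ⊃ 𝔓` the valuation ring and maximal ideal of `F̄`, `q = |k_F|`.  For an OPEN subgroup
`H ≤ Γ_F` containing `I_F`, of index `m = [Γ_F : H]` (i.e. `H = Gal(F̄/F_m)`, `F_m` the unramified
extension of degree `m`), and `x ∈ S`:

* `pow_eq_of_forall_mem_smul_sub_mem`: if every `τ ∈ H` fixes `x (mod 𝔓)` then
  `x^{q^m} ≡ x (mod 𝔓)` — because `φ^m ∈ H` for an arithmetic Frobenius `φ`;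
* `smul_sub_mem_of_pow_sub_mem`: conversely, if `x^{q^m} ≡ x (mod 𝔓)` then every `τ ∈ H` fixes
  `x (mod 𝔓)` — `Γ_F/H` is cyclic of order `m` on the Frobenius (density of the Weil group,
  `WeilGroup.denseRange_toAbsGalois_holds`), so the elements of `H` have Frobenius degree `≡ 0 (m)`
  near any point, and act trivially on the primitive `(q^m-1)`-th roots of unity of `k̄ = S/𝔓`.

That is: the subfield of `k̄` fixed by `H` is exactly `𝔽_{q^m}`; equivalently the residue field of
`F_m` is `𝔽_{q^m}` (Serre, *Local Fields*, Ch. III §5, Thm. 3: unramified extensions correspond to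
extensions of the residue field, with the same Galois group).  Input of the unramifiedness
criterion `mlf_unramified_criterion` of abc-iut L4 (`MLFReciprocityInputs.lean`).
Proof-only: no definitions.
-/

noncomputable section

open scoped Pointwise Valued IntermediateField
open ValuativeRel Field

namespace Literature.NumberTheory.GaloisRepresentations

open GaloisRepresentations.IsNonarchimedeanLocalField

variable {F : Type*} [Field F] [ValuativeRel F] [TopologicalSpace F] [IsNonarchimedeanLocalField F]

/-- A subgroup of `Γ_F` containing `I_F` is normal (`closure [Γ_F, Γ_F] ≤ I_F`: `Γ_F/I_F` is
abelian). Serre, *Local Fields*, Ch. XIII §4 (`F_nr ⊆ F^ab`). [cite: SerreLocalFields1979, Ch. XIII §4] -/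
theorem normal_of_absInertia_le {H : Subgroup (absoluteGaloisGroup F)} (hI : absInertia F ≤ H) :
    H.Normal := by
  refine ⟨fun h hh g => ?_⟩
  have hc : g * h * g⁻¹ * h⁻¹ ∈ absInertia F := by
    apply WeilGroup.topologicalClosure_commutator_absGalois_le_absInertia
      (WeilGroup.denseRange_toAbsGalois_holds F)
    apply Subgroup.le_topologicalClosure
    exact Subgroup.commutator_mem_commutator (Subgroup.mem_top g) (Subgroup.mem_top h)
  have : g * h * g⁻¹ = (g * h * g⁻¹ * h⁻¹) * h := by group
  rw [this]
  exact H.mul_mem (hI hc) hh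

/-- **Cosets of an open subgroup `H ⊇ I_F` are represented by powers of a Frobenius**: for every
`g ∈ Γ_F` there is `j ∈ ℤ` with `φ^{-j} g ∈ H` (the Weil group `⋃ φ^j I_F` is dense).
Serre, *Local Fields*, Ch. XIII §4; Tate (Corvallis 1979) (1.4.1). [cite: SerreLocalFields1979, Ch. XIII §4] -/
theorem exists_zpow_inv_mul_mem {H : Subgroup (absoluteGaloisGroup F)} (hI : absInertia F ≤ H)
    (hH : IsOpen (H : Set (absoluteGaloisGroup F))) {φ : absoluteGaloisGroup F} (hφ : IsFrobPow φ 1)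
    (g : absoluteGaloisGroup F) : ∃ j : ℤ, (φ ^ j)⁻¹ * g ∈ H := by
  haveI := normal_of_absInertia_le hI
  -- a Weil group element `w` in the open set `g H`
  have hopen : IsOpen {w : absoluteGaloisGroup F | g⁻¹ * w ∈ (H : Set (absoluteGaloisGroup F))} :=
    hH.preimage (continuous_const_mul g⁻¹)
  obtain ⟨a, ha⟩ := (WeilGroup.denseRange_toAbsGalois_holds F).exists_mem_open hopen
    ⟨g, by simp [H.one_mem]⟩
  set w := WeilGroup.toAbsGalois F a with hw
  have hwW : w ∈ weilSubgroup F := by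
    rw [← WeilGroup.range_toAbsGalois]; exact ⟨a, rfl⟩
  obtain ⟨j, hj⟩ := (mem_weilSubgroup_iff IsFrobPow.mul_holds).mp hwW
  refine ⟨j, ?_⟩
  -- `w φ^{-j} ∈ I_F ≤ H`, `g⁻¹ w ∈ H`
  have h1 : w * (φ ^ j)⁻¹ ∈ H := hI (IsFrobPow.mul_inv_mem_absInertia_holds hj (by
    simpa using hφ.zpow j))
  have h2 : (φ ^ j)⁻¹ * w ∈ H := by
    have := Subgroup.Normal.conj_mem inferInstance _ h1 (φ ^ j)⁻¹
    simpa [mul_assoc] using this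
  have h3 : g⁻¹ * w ∈ H := ha
  have : (φ ^ j)⁻¹ * g = ((φ ^ j)⁻¹ * w) * (g⁻¹ * w)⁻¹ := by group
  rw [this]
  exact H.mul_mem h2 (H.inv_mem h3)

/-- For an open `H ⊇ I_F` of finite index `m` and a Frobenius `φ`: `φ^j ∈ H ↔ m ∣ j` (`Γ_F/H` is
cyclic of order `m` generated by `φ`). Serre, *Local Fields*, Ch. III §5, Ch. XIII §4.
[cite: SerreLocalFields1979, Ch. XIII §4] -/
theorem zpow_mem_iff_index_dvd {H : Subgroup (absoluteGaloisGroup F)} (hI : absInertia F ≤ H)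
    (hH : IsOpen (H : Set (absoluteGaloisGroup F))) [H.FiniteIndex] {φ : absoluteGaloisGroup F}
    (hφ : IsFrobPow φ 1) (j : ℤ) : φ ^ j ∈ H ↔ (H.index : ℤ) ∣ j := by
  haveI := normal_of_absInertia_le hI
  -- `mk φ` generates `Γ_F ⧸ H`, so its order is `m`
  have hgen : ∀ x : absoluteGaloisGroup F ⧸ H, x ∈ Subgroup.zpowers (QuotientGroup.mk φ : _ ⧸ H) := by
    intro x
    obtain ⟨g, rfl⟩ := QuotientGroup.mk_surjective x
    obtain ⟨j, hj⟩ := exists_zpow_inv_mul_mem hI hH hφ g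
    refine ⟨j, ?_⟩
    change (QuotientGroup.mk φ : _ ⧸ H) ^ j = QuotientGroup.mk g
    rw [← QuotientGroup.mk_zpow, QuotientGroup.eq]
    exact hj
  have hord : orderOf (QuotientGroup.mk φ : absoluteGaloisGroup F ⧸ H) = H.index := by
    rw [orderOf_eq_card_of_forall_mem_zpowers hgen, Subgroup.index]
  rw [← hord, orderOf_dvd_iff_zpow_eq_one, ← QuotientGroup.mk_zpow, QuotientGroup.eq_one_iff]

/-- **If `H ⊇ I_F` (finite index `m`) fixes `x (mod 𝔓)` then `x^{q^m} ≡ x (mod 𝔓)`**: `φ^m ∈ H`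
acts as `x ↦ x^{q^m}` modulo `𝔓`. Serre, *Local Fields*, Ch. III §5, Thm. 3.
[cite: SerreLocalFields1979, Ch. III §5 Thm. 3] -/
theorem pow_sub_mem_of_forall_mem_smul_sub_mem {H : Subgroup (absoluteGaloisGroup F)}
    (hI : absInertia F ≤ H) [H.FiniteIndex] (x : absIntegers 𝒪[F] F)
    (hx : ∀ τ ∈ H, τ • x - x ∈ absMaximalIdeal F) :
    x ^ (residueFieldCard F ^ H.index) - x ∈ absMaximalIdeal F := by
  haveI := normal_of_absInertia_le hI
  obtain ⟨φ, hφ⟩ := exists_isAbsArithFrob_holds F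
  have hφ1 : IsFrobPow φ 1 := IsAbsArithFrob.isFrobPow_holds hφ
  have hφm : IsFrobPow (φ ^ H.index) (H.index : ℕ) := by
    have := hφ1.pow H.index
    simpa using this
  have h1 : (φ ^ H.index) • x - x ^ residueFieldCard F ^ H.index ∈ absMaximalIdeal F :=
    (isFrobPow_natCast_iff.mp hφm) x
  have h2 := hx _ (H.pow_index_mem φ)
  have := Ideal.sub_mem _ h2 h1
  rwa [sub_sub_sub_cancel_left] at this

/-- Membership in `𝔓` is `Γ_F`-invariant (`σ • 𝔓 = 𝔓`). [folklore] -/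
private theorem smul_mem_absMaximalIdeal' (σ : absoluteGaloisGroup F) {y : absIntegers 𝒪[F] F}
    (hy : y ∈ absMaximalIdeal F) : σ • y ∈ absMaximalIdeal F := by
  have h : σ • y ∈ σ • absMaximalIdeal F := Ideal.smul_mem_pointwise_smul _ _ _ hy
  rwa [smul_absMaximalIdeal_holds F σ] at h

-- the tower of quotient fields `𝒪[F] ⧸ 𝔓 ∩ 𝒪[F] → S ⧸ 𝔓` makes instance synthesis slow
set_option maxHeartbeats 800000 in
set_option synthInstance.maxHeartbeats 100000 in
/-- **If `x^{q^m} ≡ x (mod 𝔓)` then every `τ` in the open subgroup `H ⊇ I_F` of index `m` fixes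
`x (mod 𝔓)`**: the residue field of the unramified extension `F_m` (fixed field of `H`) contains —
hence is — `𝔽_{q^m}`.  Near `τ`, inside `H` and the stabiliser of a lift `s` of a primitive
`(q^m-1)`-th root of unity `ω` of `k̄`, there is a Weil group element `w` (density); its degree `j`
has `φ^j ∈ H`, so `m ∣ j` and `w`, i.e. `τ`, fixes `ω`; and `x̄ ∈ 𝔽_{q^m} = 𝔽_q(ω)`.
Serre, *Local Fields*, Ch. III §5, Thm. 3; Ch. I §8. [cite: SerreLocalFields1979, Ch. III §5 Thm. 3] -/
theorem smul_sub_mem_of_pow_sub_mem {H : Subgroup (absoluteGaloisGroup F)} (hI : absInertia F ≤ H)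
    (hH : IsOpen (H : Set (absoluteGaloisGroup F))) [H.FiniteIndex] (x : absIntegers 𝒪[F] F)
    (hx : x ^ (residueFieldCard F ^ H.index) - x ∈ absMaximalIdeal F) {τ : absoluteGaloisGroup F}
    (hτ : τ ∈ H) : τ • x - x ∈ absMaximalIdeal F := by
  classical
  -- the residue fields
  haveI h𝔓 : (absMaximalIdeal F).IsMaximal := absMaximalIdeal_isMaximal_holds F
  letI := Ideal.Quotient.field (absMaximalIdeal F)
  haveI : ((absMaximalIdeal F).under 𝒪[F]).IsMaximal := Ideal.IsMaximal.under 𝒪[F] _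
  letI := Ideal.Quotient.field ((absMaximalIdeal F).under 𝒪[F])
  haveI : Finite (𝒪[F] ⧸ (absMaximalIdeal F).under 𝒪[F]) := Nat.finite_of_card_ne_zero (by
    rw [card_quotient_under_absMaximalIdeal_holds F]
    exact residueFieldCard_ne_zero F)
  letI : Fintype (𝒪[F] ⧸ (absMaximalIdeal F).under 𝒪[F]) := Fintype.ofFinite _
  have hq2 : 2 ≤ residueFieldCard F := one_lt_residueFieldCard F
  haveI : IsAlgClosed (absIntegers 𝒪[F] F ⧸ absMaximalIdeal F) :=
    isAlgClosed_quotient_absMaximalIdeal F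
  have hqR : ((residueFieldCard F : ℕ) : absIntegers 𝒪[F] F ⧸ absMaximalIdeal F) = 0 := by
    have hq : Fintype.card (𝒪[F] ⧸ (absMaximalIdeal F).under 𝒪[F]) = residueFieldCard F := by
      rw [Fintype.card_eq_nat_card, card_quotient_under_absMaximalIdeal_holds F]
    rw [← hq, ← map_natCast (algebraMap (𝒪[F] ⧸ (absMaximalIdeal F).under 𝒪[F])
      (absIntegers 𝒪[F] F ⧸ absMaximalIdeal F)), FiniteField.cast_card_eq_zero, map_zero]
  set m := H.index with hm
  have hm0 : 0 < m := Nat.pos_of_ne_zero Subgroup.FiniteIndex.index_ne_zero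
  -- a primitive `(q^m - 1)`-th root of unity `ω` of `k̄` and a lift `s ∈ S`
  set n₀ : ℕ := residueFieldCard F ^ m - 1 with hn₀
  have hqm : 1 < residueFieldCard F ^ m := Nat.one_lt_pow hm0.ne' hq2
  haveI : NeZero n₀ := ⟨by omega⟩
  haveI : NeZero (n₀ : absIntegers 𝒪[F] F ⧸ absMaximalIdeal F) := ⟨by
    rw [hn₀, Nat.cast_sub hqm.le, Nat.cast_pow, hqR, zero_pow hm0.ne', Nat.cast_one, zero_sub]
    exact neg_ne_zero.mpr one_ne_zero⟩
  obtain ⟨ω, hω⟩ := HasEnoughRootsOfUnity.prim (M := absIntegers 𝒪[F] F ⧸ absMaximalIdeal F)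
    (n := n₀)
  have hω0 : ω ≠ 0 := hω.ne_zero (NeZero.ne n₀)
  obtain ⟨s, hs⟩ := Ideal.Quotient.mk_surjective ω
  -- `ω ^ (q ^ j) = ω` whenever `m ∣ j`
  have hωpow : ∀ j : ℕ, m ∣ j → ω ^ (residueFieldCard F ^ j) = ω := by
    intro j hj
    have hqj : 1 ≤ residueFieldCard F ^ j := Nat.one_le_pow _ _ (by omega)
    obtain ⟨c, hc⟩ := Nat.pow_sub_one_dvd_pow_sub_one (residueFieldCard F) hj
    have h1 : ω ^ (residueFieldCard F ^ j - 1) = 1 := by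
      rw [hc, pow_mul, hω.pow_eq_one, one_pow]
    calc ω ^ (residueFieldCard F ^ j) = ω ^ (residueFieldCard F ^ j - 1) * ω := by
          rw [← pow_succ, Nat.sub_add_cancel hqj]
      _ = ω := by rw [h1, one_mul]
  -- a Frobenius
  obtain ⟨φ, hφ⟩ := exists_isAbsArithFrob_holds F
  have hφ1 : IsFrobPow φ 1 := IsAbsArithFrob.isFrobPow_holds hφ
  haveI := normal_of_absInertia_le hI
  -- KEY: `τ` fixes `ω`, i.e. `τ • s ≡ s (mod 𝔓)`
  have hkey : τ • s - s ∈ absMaximalIdeal F := by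
    -- the open neighbourhood `τ (H ∩ Stab s)` of `τ`
    have hsint : IsIntegral F (s : AlgebraicClosure F) := Algebra.IsIntegral.isIntegral _
    have hstab : IsOpen ((MulAction.stabilizer (absoluteGaloisGroup F) (s : AlgebraicClosure F) :
        Subgroup (absoluteGaloisGroup F)) : Set (absoluteGaloisGroup F)) := by
      haveI : FiniteDimensional F F⟮(s : AlgebraicClosure F)⟯ :=
        IntermediateField.adjoin.finiteDimensional hsint
      refine Subgroup.isOpen_mono (H₁ := (F⟮(s : AlgebraicClosure F)⟯).fixingSubgroup) ?_
        (IntermediateField.fixingSubgroup_isOpen _)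
      intro g hg
      change g • (s : AlgebraicClosure F) = (s : AlgebraicClosure F)
      exact (IntermediateField.mem_fixingSubgroup_iff _ _).mp hg _
        (IntermediateField.mem_adjoin_simple_self F _)
    have hopen : IsOpen {w : absoluteGaloisGroup F |
        τ⁻¹ * w ∈ (H : Set (absoluteGaloisGroup F)) ∩
          (MulAction.stabilizer (absoluteGaloisGroup F) (s : AlgebraicClosure F) : Subgroup _)} :=
      (hH.inter hstab).preimage (continuous_const_mul τ⁻¹)
    obtain ⟨a, ha⟩ := (WeilGroup.denseRange_toAbsGalois_holds F).exists_mem_open hopen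
      ⟨τ, by simp [H.one_mem]⟩
    set w := WeilGroup.toAbsGalois F a with hw
    obtain ⟨hwH', hwstab⟩ := ha
    have hwH : w ∈ H := by
      have := H.mul_mem hτ hwH'
      rwa [mul_inv_cancel_left] at this
    have hws : w • s = τ • s := by
      apply Subtype.ext
      have h1 : (τ⁻¹ * w) • (s : AlgebraicClosure F) = s := hwstab
      rw [mul_smul, inv_smul_eq_iff] at h1
      exact h1
    have hwW : w ∈ weilSubgroup F := by
      rw [← WeilGroup.range_toAbsGalois]; exact ⟨a, rfl⟩
    obtain ⟨j, hj⟩ := (mem_weilSubgroup_iff IsFrobPow.mul_holds).mp hwW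
    -- `m ∣ j`
    have hφj : φ ^ j ∈ H := by
      have h1 : w * (φ ^ j)⁻¹ ∈ H :=
        hI (IsFrobPow.mul_inv_mem_absInertia_holds hj (by simpa using hφ1.zpow j))
      have := H.mul_mem (H.inv_mem hwH) h1
      rw [inv_mul_cancel_left] at this
      exact (Subgroup.inv_mem_iff H).mp this
    have hmj : (m : ℤ) ∣ j := (zpow_mem_iff_index_dvd hI hH hφ1 j).mp hφj
    rw [← hws]
    -- `w` acts as `Frob^j` with `m ∣ j`
    rcases Int.eq_nat_or_neg j with ⟨n, rfl | rfl⟩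
    · have hmn : m ∣ n := by exact_mod_cast hmj
      have h1 : w • s - s ^ residueFieldCard F ^ n ∈ absMaximalIdeal F :=
        (isFrobPow_natCast_iff.mp hj) s
      rw [← Ideal.Quotient.eq] at h1 ⊢
      rw [h1, map_pow, hs, hωpow n hmn]
    · have hmn : m ∣ n := by
        have : (m : ℤ) ∣ (n : ℤ) := (Int.dvd_neg).mp hmj
        exact_mod_cast this
      have hinv : IsFrobPow w⁻¹ (n : ℕ) := by simpa using hj.inv
      have h1 : w⁻¹ • s - s ^ residueFieldCard F ^ n ∈ absMaximalIdeal F :=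
        (isFrobPow_natCast_iff.mp hinv) s
      have h2 : w⁻¹ • s - s ∈ absMaximalIdeal F := by
        rw [← Ideal.Quotient.eq] at h1 ⊢
        rw [h1, map_pow, hs, hωpow n hmn]
      have h3 := smul_mem_absMaximalIdeal' w h2
      rw [smul_sub, smul_inv_smul] at h3
      rw [← Ideal.neg_mem_iff, neg_sub]
      exact h3
  -- conclusion: `x̄ = 0` or `x̄ = ω^i`
  have hσst : τ ∈ MulAction.stabilizer (absoluteGaloisGroup F) (absMaximalIdeal F) :=
    smul_absMaximalIdeal_holds F τ
  let ρ : (absIntegers 𝒪[F] F ⧸ absMaximalIdeal F) ≃ₐ[𝒪[F] ⧸ (absMaximalIdeal F).under 𝒪[F]]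
      (absIntegers 𝒪[F] F ⧸ absMaximalIdeal F) :=
    Ideal.Quotient.stabilizerHom (absMaximalIdeal F) ((absMaximalIdeal F).under 𝒪[F])
      (absoluteGaloisGroup F) ⟨τ, hσst⟩
  have hρ : ∀ z : absIntegers 𝒪[F] F,
      ρ (Ideal.Quotient.mk _ z) = Ideal.Quotient.mk _ (τ • z) := fun z =>
    Ideal.Quotient.stabilizerHom_apply _ _ _ ⟨τ, hσst⟩ z
  have hρω : ρ ω = ω := by
    rw [← hs, hρ, Ideal.Quotient.eq]
    exact hkey
  rw [← Ideal.Quotient.eq, ← hρ]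
  set y := Ideal.Quotient.mk (absMaximalIdeal F) x with hy
  by_cases hy0 : y = 0
  · rw [hy0, map_zero]
  have hyq : y ^ (residueFieldCard F ^ m) = y := by
    have := (Ideal.Quotient.eq (I := absMaximalIdeal F)).mpr hx
    rwa [map_pow] at this
  have hyn₀ : y ^ n₀ = 1 := by
    have : y ^ (residueFieldCard F ^ m - 1) * y = y := by
      rw [← pow_succ, Nat.sub_add_cancel hqm.le, hyq]
    exact (mul_left_eq_self₀.mp this).resolve_right hy0
  obtain ⟨i, -, hiy⟩ := hω.eq_pow_of_pow_eq_one hyn₀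
  rw [← hiy, map_pow, hρω]

end Literature.NumberTheory.GaloisRepresentations
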